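import Summits.BirchSwinnertonDyer.Rank1Residual.Additive.RamifiedTwistMinimality
import Summits.BirchSwinnertonDyer.Rank1Residual.Additive.GordKodairaType
import Summits.BirchSwinnertonDyer.Rank1Residual.EisensteinPrimes
import Literature.NumberTheory.EllipticCurves.QuadraticTwistMinimalModelProofs
import Literature.NumberTheory.EllipticCurves.QuadraticTwistIntegralModel
import Literature.NumberTheory.EllipticCurves.QuadraticTwistJInvariantProofs
import Literature.NumberTheory.EllipticCurves.RootNumberSmulProofs
import Literature.NumberTheory.EllipticCurves.GlobalMinimalModelProofs
import Literature.NumberTheory.DiophantineGeometry.ConductorFactorizationProofs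
import HarnessLib

/-!
# X3/X4 at an additive prime: the `p`-ADIC DICTIONARY OF THE TWIST PAIR `(E, E ⊗ χ_{p*})` —
# `ord_p u = 0`, `ord_p Δ_min ↦ ord_p Δ_min + 6`, additivity, and `N(E ⊗ χ_{p*}) = N(E)`

HONEST FRAMING (cell `b2b-bsdres`, run/shared/lean/b2b/bsd-rank1-residual/, verbatim in every
file): the goal of the cell is to DELETE the COMBINATION-SHAPED residual classes of the
Birch–Swinnerton-Dyer formula for ALL analytic-rank `≤ 1` elliptic curves over `ℚ` — "full BSD
formula for every rank `≤ 1` curve in class `C`" assembled STRICTLY from published theorems — so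
that the rank-`≤ 1` remainder becomes exactly the CONSTRUCTION-SHAPED classes, which are TYPED
(missing-input `Prop`s), NOT attempted. This is not "finishing BSD". Sub-cell `additive-p2`
(CLASS-OWNERS row "X3/X4 additive — pot. good ordinary / X3♯(G-ord)"), generation 17: research
route; no claim beyond the stated classes; theorems only, no definition, no named fact;
X3♯(G-ord)/X4♯(G-ord) stay CONSTRUCTION-SHAPED; no label moves; nothing is booked.

WHAT THIS FILE DOES. Companion of `GordTwistDegreeIdentity.lean` (the identity
`p · deg · c♭² = deg♭ · u² · c²` for an additive pair and its `p*`-twist). To read that identity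
`p`-adically, and to move parametrisation data between the conductor levels of `E` and of
`E ⊗ χ_{p*}`, one needs the local bookkeeping of the pair `(V, W)` with `C • V^{(±p)} = W`, `V` and
`W` globally minimal, `V` with `ord_p Δ_min(V) < 6` (good reduction, or the UNSTARRED potentially
good types II / III / IV at `p ≥ 5`, `ord_p Δ_min ∈ {2, 3, 4}` — `GordKodairaType.lean`). This is
additive-p4's `RamifiedTwistMinimality` / `RamifiedTwistConductor` (there for `V` SEMISTABLE at `p`),
redone for `ord_p Δ_min(V) < 6`:
* §1 `isMinimalAt_quadraticTwist_pm_p_of_lt_six` — the tree's twisted model `V^{(±p)}`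
  (`a₂ = d b₂/4, a₄ = d² b₄/2, a₆ = d³ b₆/4`) is `p`-integral and `p`-MINIMAL:
  `ord_p Δ(V^{(±p)}) = 6 + ord_p Δ_min(V) < 12` (Silverman *AEC* VII.1 Remark 1.1, tree
  `isMinimalAt_of_lt_valuation_Δ_holds`); hence `padicValRat_u_eq_zero_of_twist_pm_p_of_lt_six`:
  **`ord_p u(C) = 0`** for any `C` with `C • V^{(±p)} = W` globally minimal (two `p`-minimal equations
  differ by a `p`-unit, *AEC* VII.1.3 (b), tree `exists_algebraMap_eq_u_of_isMinimal`; this is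
  Pal 2012 Prop. 2.5 "`u_p = 1` if `λ_{v_p} < 6`").
* §2 `padicValInt_minimalDiscriminantInt_twist_pm_p_of_lt_six` — **`ord_p Δ_min(W) =
  ord_p Δ_min(V) + 6`** (`Δ(C • X) = u⁻¹² Δ(X)`, `Δ(V^{(d)}) = d⁶ Δ(V)`); `addv_of_twist_pm_p_of_lt_six`
  — if moreover `ord_p j(V) ≥ 0` then **`W` is ADDITIVE at `p`, potentially good
  (`ord_p j(W) = ord_p j(V) ≥ 0`), with `ord_p Δ_min(W) ≥ 6`** (`p ∣ Δ_min(W)` kills good reduction,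
  `ord_p j ≥ 0` kills multiplicative reduction — `EisensteinPrimes.padicValRat_j_neg_of_mult`). So the
  `p*`-twist of a pair of type II / III / IV (`ord_p Δ_min = 2, 3, 4`) is a pair of type
  IV* / III* / II* (`ord_p Δ_min = 8, 9, 10`) — the involution of the census law.
* §3 `conductorNorm_eq_of_twist_pStar` — **`N(W) = N(V)`** for `C • V^{(p*)} = W` with `V, W` both
  additive at `p ≥ 5`: at `p` both conductor exponents are `2` (gen 9's
  `condExpTwo_of_addv_of_five_le`); at a place `v ∤ p` the twist by `p* = 4k + 1 ≡ 1 (mod 4)` is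
  UNRAMIFIED, `V^{(p*)} ≅ V.twistModel k` (tree `exists_variableChange_twistModel_eq_quadraticTwist`)
  and `f_v` is unchanged (tree `conductorExponent_twistModel`, Comalada 1994 §2 / Connell §4.3;
  `conductorExponent_smul'`); `N = ∏ p^{f_p}` (`factorization_conductorNorm_holds`). Consequence:
  the newforms of `E` and `E ⊗ χ_{p*}` live on the SAME `Γ₀(N)` — the hypothesis "same level" of the
  twist identity is automatic at the conductor levels.
* §4 `exists_minimal_twist_pStar` — every `V` has a globally minimal model `W` of its `p*`-twist with
  `C • V^{(p*)} = W` (tree `hasGlobalMinimalModel_rat_holds`); `pStar_intCast` (`p* = ±p` as an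
  integer).
Nothing here changes a label; no consumer of a named fact.

References: J. H. Silverman, *AEC* VII.1 Remark 1.1, Prop. VII.1.3 (b), VII.5 Prop. 5.1, X.2
Ex. 10.16 [SilvermanAEC2009]; *ATAEC* IV.9.4 Table 4.1, IV.10–11 [SilvermanATAEC1994]; V. Pal,
*Periods of quadratic twists of elliptic curves*, Proc. AMS 140 (2012) Prop. 2.5 [Pal2012];
S. Comalada, J. Number Theory 49 (1994) §2; I. Connell, *Elliptic Curve Handbook* §4.3.
-/

noncomputable section

open scoped Classical NumberField

open WeierstrassCurve IsDedekindDomain IsDedekindDomain.HeightOneSpectrum NumberField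
  Rat.HeightOneSpectrum Literature.NumberTheory.EllipticCurves
  Literature.NumberTheory.EllipticCurves.Rank1Residual
  Literature.NumberTheory.DiophantineGeometry

namespace Summit.BirchSwinnertonDyer.Rank1Residual.Additive

variable (p : ℕ) [hp : Fact p.Prime]

/-! ### §1 `p`-minimality of the twisted model; `ord_p u = 0` -/

/-- The rational prime below `placeOf p` is `p`. [folklore] -/
theorem natGenerator_placeOf_eq : natGenerator (placeOf p) = p :=
  Literature.NumberTheory.EllipticCurves.Rat.natGenerator_primesEquiv_symm ⟨p, hp.out⟩

/-- **`|Δ(V)|_{(p)} = exp(−ord_p Δ_min(V))`** for a globally minimal `V/ℚ` (its discriminant IS the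
minimal discriminant, `cast_minimalDiscriminantInt`). [cite: SilvermanAEC2009, VIII.8 (minimal discriminant)] -/
theorem valuation_placeOf_Δ_eq (V : WeierstrassCurve ℚ) [V.IsElliptic] [V.IsGloballyMinimal] :
    (placeOf p).valuation ℚ V.Δ =
      WithZero.exp (-(padicValInt p V.minimalDiscriminantInt : ℤ)) := by
  have h0 : (V.minimalDiscriminantInt : ℚ) ≠ 0 := by exact_mod_cast V.minimalDiscriminantInt_ne_zero
  rw [← cast_minimalDiscriminantInt V, Rat.HeightOneSpectrum.valuation_eq_exp_neg_padicValRat _ h0,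
    natGenerator_placeOf_eq, padicValRat.of_int]

/-- **The twisted model `V^{(±p)}` is `p`-MINIMAL when `ord_p Δ_min(V) < 6`** (`p` odd, `V`
globally minimal): it is `p`-integral (additive-p4's `isIntegralAt_quadraticTwist_intCast`, `2 ∈ ℤ_pˣ`)
and `ord_p Δ(V^{(±p)}) = 6 + ord_p Δ_min(V) < 12` (`Δ(V^{(d)}) = d⁶ Δ(V)`), so Silverman's criterion
*AEC* VII.1 Remark 1.1 (tree `isMinimalAt_of_lt_valuation_Δ_holds`) applies. Covers `V` good at `p`
(`ord_p Δ_min = 0`, additive-p4's case) and `V` of the UNSTARRED potentially good Kodaira types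
II / III / IV at `p ≥ 5` (`ord_p Δ_min = 2, 3, 4`). This is Pal 2012 Prop. 2.5's condition
"`λ_{v_p}(E) = min(3v(c₄), 2v(c₆), v(Δ)) < 6`" on the discriminant side.
[cite: SilvermanAEC2009, VII.1 Remark 1.1] [cite: Pal2012, Prop. 2.5] -/
theorem isMinimalAt_quadraticTwist_pm_p_of_lt_six (hp2 : p ≠ 2) (V : WeierstrassCurve ℚ)
    [V.IsElliptic] [V.IsGloballyMinimal] (hV : padicValInt p V.minimalDiscriminantInt < 6)
    {d : ℤ} (hd : d = p ∨ d = -p) :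
    (V.quadraticTwist (d : ℚ)).IsMinimalAt (placeOf p) := by
  have hint : (V.quadraticTwist (d : ℚ)).IsIntegralAt (placeOf p) :=
    isIntegralAt_quadraticTwist_intCast p hp2 V d
  have hdval : (placeOf p).valuation ℚ (d : ℚ) = WithZero.exp (-1 : ℤ) := valuation_pm_p p hd
  refine isMinimalAt_of_lt_valuation_Δ_holds (v := placeOf p) (W := V.quadraticTwist (d : ℚ)) hint ?_
  have hk0 : 0 ≤ padicValInt p V.minimalDiscriminantInt := by positivity
  rw [quadraticTwist_Δ, map_mul, map_pow, hdval, valuation_placeOf_Δ_eq p V, ← WithZero.exp_nsmul,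
    ← WithZero.exp_add]
  exact WithZero.exp_lt_exp.mpr (by rw [nsmul_eq_mul]; push_cast; omega)

/-- **`ord_p u(C) = 0`** for a change of variables `C` over `ℚ` from the twisted model `V^{(±p)}`
(`V` globally minimal with `ord_p Δ_min(V) < 6`, `p` odd) to a globally minimal `W`: both equations
are `p`-minimal (`isMinimalAt_quadraticTwist_pm_p_of_lt_six`, `IsGloballyMinimal.isMinimalAt_int`),
so `u ∈ ℤ_pˣ` (Silverman *AEC* VII.1 Prop. 1.3 (b); tree `exists_algebraMap_eq_u_of_isMinimal`).
Verbatim the argument of additive-p4's `padicValRat_u_eq_zero_of_twist_pm_p` (there for `V`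
semistable at `p`). [cite: SilvermanAEC2009, VII.1 Prop. 1.3(b)] [cite: Pal2012, Prop. 2.5] -/
theorem padicValRat_u_eq_zero_of_twist_pm_p_of_lt_six (hp2 : p ≠ 2) (V W : WeierstrassCurve ℚ)
    [V.IsElliptic] [V.IsGloballyMinimal] [W.IsGloballyMinimal]
    (hV : padicValInt p V.minimalDiscriminantInt < 6) {d : ℤ}
    (hd : d = p ∨ d = -p) (C : VariableChange ℚ) (hC : C • V.quadraticTwist (d : ℚ) = W) :
    padicValRat p (C.u : ℚ) = 0 := by
  -- adapted from `Additive/RamifiedTwistMinimality.lean` (additive-p4), `p`-minimality from §1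
  set v : HeightOneSpectrum ℤ := placeOf p with hv
  have hgen : natGenerator v = p := natGenerator_placeOf_eq p
  set X : WeierstrassCurve ℚ := V.quadraticTwist (d : ℚ) with hX
  have hd0 : (d : ℚ) ≠ 0 := by
    rcases hd with rfl | rfl <;> push_cast <;> simp [hp.out.ne_zero]
  haveI : X.IsElliptic := V.isElliptic_quadraticTwist hd0
  -- both `X` and `W = C • X` are minimal over `O_v`
  haveI hXmin : IsMinimal (v.adicCompletionIntegers ℚ) (X.baseChange (v.adicCompletion ℚ)) :=
    isMinimalAt_quadraticTwist_pm_p_of_lt_six p hp2 V hV hd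
  haveI : IsMinimal (v.adicCompletionIntegers ℚ)
      ((C.baseChange (v.adicCompletion ℚ)) • (X.baseChange (v.adicCompletion ℚ))) := by
    rw [VariableChange.baseChange, baseChange, map_variableChange, hC]
    exact IsGloballyMinimal.isMinimalAt_int W v
  have hΔ : (X.baseChange (v.adicCompletion ℚ)).Δ ≠ 0 := by
    rw [baseChange, map_Δ]
    exact (map_ne_zero _).mpr (isUnit_Δ X).ne_zero
  obtain ⟨⟨a, ha⟩, ⟨b, hb⟩⟩ := exists_algebraMap_eq_u_of_isMinimal (v.adicCompletionIntegers ℚ)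
    (X.baseChange (v.adicCompletion ℚ)) (C.baseChange (v.adicCompletion ℚ)) hΔ
  rw [VariableChange.baseChange] at ha hb
  rw [VariableChange.map_u, Units.coe_map, MonoidHom.coe_coe] at ha
  rw [VariableChange.map_u, Units.coe_map_inv, MonoidHom.coe_coe] at hb
  have hu1 : v.valuation ℚ (C.u : ℚ) ≤ 1 := by
    have h := a.2
    rw [HeightOneSpectrum.mem_adicCompletionIntegers, ← ValuationSubring.algebraMap_apply, ha] at h
    rwa [← HeightOneSpectrum.valuedAdicCompletion_eq_valuation']
  have hu2 : v.valuation ℚ (↑C.u⁻¹ : ℚ) ≤ 1 := by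
    have h := b.2
    rw [HeightOneSpectrum.mem_adicCompletionIntegers, ← ValuationSubring.algebraMap_apply, hb] at h
    rwa [← HeightOneSpectrum.valuedAdicCompletion_eq_valuation']
  have hu0 : (C.u : ℚ) ≠ 0 := C.u.ne_zero
  have hval : v.valuation ℚ (C.u : ℚ) = 1 := by
    refine le_antisymm hu1 ?_
    rw [Units.val_inv_eq_inv_val, map_inv₀] at hu2
    have hpos : 0 < v.valuation ℚ (C.u : ℚ) := by
      rw [Valuation.pos_iff]
      exact hu0
    exact (inv_le_one₀ hpos).mp hu2
  have h := Rat.HeightOneSpectrum.valuation_eq_exp_neg_padicValRat v hu0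
  rw [hval, hgen] at h
  have h' : (0 : ℤ) = -padicValRat p (C.u : ℚ) := by
    rw [← WithZero.exp_zero] at h
    exact WithZero.exp_injective h
  omega

/-! ### §2 `ord_p Δ_min ↦ ord_p Δ_min + 6`; the twist of an unstarred pair is a starred additive pair -/

/-- **`ord_p Δ_min(W) = ord_p Δ_min(V) + 6`** for `C • V^{(±p)} = W`, `V, W` globally minimal,
`ord_p Δ_min(V) < 6`, `p` odd: `Δ(W) = u⁻¹² (±p)⁶ Δ(V)` (`variableChange_Δ`, `quadraticTwist_Δ`)
with `ord_p u = 0` (§1). II ↦ IV*, III ↦ III*, IV ↦ II* (`ord_p Δ_min`: `2 ↦ 8`, `3 ↦ 9`,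
`4 ↦ 10`); good ↦ I₀* (`0 ↦ 6`). [cite: SilvermanATAEC1994, IV Table 4.1 (PDF p. 365)]
[cite: Pal2012, Prop. 2.5] -/
theorem padicValInt_minimalDiscriminantInt_twist_pm_p_of_lt_six (hp2 : p ≠ 2)
    (V W : WeierstrassCurve ℚ) [V.IsElliptic] [V.IsGloballyMinimal] [W.IsElliptic]
    [W.IsGloballyMinimal] (hV : padicValInt p V.minimalDiscriminantInt < 6) {d : ℤ}
    (hd : d = p ∨ d = -p) (C : VariableChange ℚ) (hC : C • V.quadraticTwist (d : ℚ) = W) :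
    padicValInt p W.minimalDiscriminantInt = padicValInt p V.minimalDiscriminantInt + 6 := by
  have hu0 : (C.u : ℚ) ≠ 0 := C.u.ne_zero
  have hd0 : (d : ℚ) ≠ 0 := by
    rcases hd with rfl | rfl <;> push_cast <;> simp [hp.out.ne_zero]
  have hVΔ : (V.minimalDiscriminantInt : ℚ) ≠ 0 := by exact_mod_cast V.minimalDiscriminantInt_ne_zero
  have hu := padicValRat_u_eq_zero_of_twist_pm_p_of_lt_six p hp2 V W hV hd C hC
  have hdv : padicValRat p (d : ℚ) = 1 := by
    rcases hd with rfl | rfl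
    · push_cast; exact_mod_cast padicValRat.self hp.out.one_lt
    · push_cast; rw [padicValRat.neg]; exact_mod_cast padicValRat.self hp.out.one_lt
  -- `Δ(W) = u⁻¹² d⁶ Δ(V)`
  have hΔ : (W.minimalDiscriminantInt : ℚ) =
      (C.u : ℚ)⁻¹ ^ 12 * ((d : ℚ) ^ 6 * V.minimalDiscriminantInt) := by
    rw [cast_minimalDiscriminantInt, cast_minimalDiscriminantInt, ← hC, variableChange_Δ,
      quadraticTwist_Δ, Units.val_inv_eq_inv_val]
  have key : (padicValInt p W.minimalDiscriminantInt : ℤ) =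
      padicValRat p ((C.u : ℚ)⁻¹ ^ 12 * ((d : ℚ) ^ 6 * V.minimalDiscriminantInt)) := by
    rw [← padicValRat.of_int, hΔ]
  rw [padicValRat.mul (pow_ne_zero _ (inv_ne_zero hu0)) (mul_ne_zero (pow_ne_zero _ hd0) hVΔ),
    padicValRat.mul (pow_ne_zero _ hd0) hVΔ, padicValRat.pow, padicValRat.pow, padicValRat.inv, hu,
    hdv, padicValRat.of_int] at key
  simp only [neg_zero, mul_zero, mul_one, zero_add, Nat.cast_ofNat] at key
  omega

/-- **The `±p`-twist of a potentially good pair with `ord_p Δ_min < 6` is an ADDITIVE, potentially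
good pair with `ord_p Δ_min ≥ 6`.** For `C • V^{(±p)} = W` (`V, W` globally minimal, `p` odd,
`0 ≤ ord_p j(V)`, `ord_p Δ_min(V) < 6`): `p ∣ Δ_min(W)` (§2: `ord_p Δ_min(W) ≥ 6`), so `W` is not
good at `p` (`not_hasGoodReductionAtPrime_of_dvd_minimalDiscriminantInt`); `j(W) = j(V)` has
`ord_p ≥ 0`, so `W` is not multiplicative at `p` (Silverman *AEC* VII.5 Prop. 5.1 (b),
`EisensteinPrimes.padicValRat_j_neg_of_mult`). In particular the `p*`-twist of an UNSTARRED
additive pair (II / III / IV) lies in the STARRED additive cell (IV* / III* / II*).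
[cite: SilvermanAEC2009, VII.5 Prop. 5.1] [cite: SilvermanATAEC1994, IV Table 4.1 (PDF p. 365)] -/
theorem addv_of_twist_pm_p_of_lt_six (hp2 : p ≠ 2) (V W : WeierstrassCurve ℚ) [V.IsElliptic]
    [V.IsGloballyMinimal] [W.IsElliptic] [W.IsGloballyMinimal] (hj : 0 ≤ padicValRat p V.j)
    (hV : padicValInt p V.minimalDiscriminantInt < 6) {d : ℤ} (hd : d = p ∨ d = -p)
    (C : VariableChange ℚ) (hC : C • V.quadraticTwist (d : ℚ) = W) :
    Addv W p ∧ 0 ≤ padicValRat p W.j ∧ 6 ≤ padicValInt p W.minimalDiscriminantInt := by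
  have hd0 : (d : ℚ) ≠ 0 := by
    rcases hd with rfl | rfl <;> push_cast <;> simp [hp.out.ne_zero]
  haveI : (V.quadraticTwist (d : ℚ)).IsElliptic := V.isElliptic_quadraticTwist hd0
  have hvW := padicValInt_minimalDiscriminantInt_twist_pm_p_of_lt_six p hp2 V W hV hd C hC
  have hk0 : 0 ≤ padicValInt p V.minimalDiscriminantInt := by positivity
  have hjW : W.j = V.j := by
    subst hC
    rw [variableChange_j, V.j_quadraticTwist hd0]
  have hjW' : 0 ≤ padicValRat p W.j := hjW ▸ hj
  refine ⟨⟨?_, ?_⟩, hjW', by omega⟩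
  · -- not good: `p ∣ Δ_min(W)`
    refine not_hasGoodReductionAtPrime_of_dvd_minimalDiscriminantInt W p ?_
    refine (padicValInt_dvd_iff 1 W.minimalDiscriminantInt).mpr (Or.inr ?_) |> fun h ↦ by
      simpa using h
    omega
  · -- not multiplicative: `ord_p j(W) ≥ 0`
    intro hmult
    have := EisensteinPrimes.padicValRat_j_neg_of_mult W p hmult
    linarith

/-! ### §3 The conductor: `N(E ⊗ χ_{p*}) = N(E)` for an additive pair at `p ≥ 5` -/

/-- `p* = 4k + 1` for an integer `k` (`p` odd; tree `four_dvd_pStar_sub_one`). [folklore] -/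
theorem exists_four_mul_add_one_eq_pStar (hp2 : p ≠ 2) :
    ∃ k : ℤ, 4 * k + 1 = (-1 : ℤ) ^ (p / 2) * p := by
  obtain ⟨c, hc⟩ := WeierstrassCurve.four_dvd_pStar_sub_one (p := p) hp2
  exact ⟨c, by linarith⟩

/-- **The conductor exponent away from `p` is unchanged by the `p*`-twist**: for `C • V^{(p*)} = W`
over `ℚ` (`p` odd) and a place `v` of `ℤ` with `v ∤ p`, `f_v(W) = f_v(V)`. The twist by
`p* = 4k + 1` is UNRAMIFIED at `v` (`|k|_v ≤ 1`, `|4k+1|_v = 1`): `V^{(p*)} ≅ V.twistModel k`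
(tree `exists_variableChange_twistModel_eq_quadraticTwist`), `f_v(V.twistModel k) = f_v(V)` (tree
`conductorExponent_twistModel`; Comalada 1994 §2, Connell §4.3), and `f_v` is an isomorphism
invariant (`conductorExponent_smul'`). [cite: SilvermanATAEC1994, IV.9.4 (PDF pp. 344–346)] -/
theorem conductorExponent_eq_of_twist_pStar_of_ne (hp2 : p ≠ 2) (V W : WeierstrassCurve ℚ)
    [V.IsElliptic] [W.IsElliptic] (C : VariableChange ℚ)
    (hC : C • V.quadraticTwist ((-1 : ℚ) ^ (p / 2) * p) = W) (v : HeightOneSpectrum ℤ)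
    (hv : natGenerator v ≠ p) : W.conductorExponent v = V.conductorExponent v := by
  obtain ⟨k, hk⟩ := exists_four_mul_add_one_eq_pStar p hp2
  have hkq : (4 * (k : ℚ) + 1) = (-1 : ℚ) ^ (p / 2) * p := by exact_mod_cast hk
  obtain ⟨C₁, -, hC₁⟩ := exists_variableChange_twistModel_eq_quadraticTwist V (k : ℚ)
  rw [hkq] at hC₁
  have hd0 : (4 * (k : ℚ) + 1) ≠ 0 := by
    rw [hkq]; exact mul_ne_zero (pow_ne_zero _ (by norm_num)) (by exact_mod_cast hp.out.ne_zero)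
  haveI : (V.twistModel (k : ℚ)).IsElliptic := by
    refine ⟨?_⟩
    rw [twistModel_Δ]
    exact (IsUnit.mk0 _ (pow_ne_zero 6 hd0)).mul V.isUnit_Δ
  haveI : (V.quadraticTwist ((-1 : ℚ) ^ (p / 2) * p)).IsElliptic :=
    V.isElliptic_quadraticTwist (by rw [← hkq]; exact hd0)
  rw [← hC, conductorExponent_smul', ← hC₁, conductorExponent_smul']
  refine conductorExponent_twistModel v V ?_ ?_
  · rw [show (k : ℚ) = algebraMap ℤ ℚ k from (eq_intCast _ k).symm]
    exact HeightOneSpectrum.valuation_le_one v k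
  · rw [show (4 * (k : ℚ) + 1 : ℚ) = ((4 * k + 1 : ℤ) : ℚ) by push_cast; ring,
      Literature.NumberTheory.EllipticCurves.Rat.valuation_intCast_eq_one_iff, hk]
    intro h
    have h' : (natGenerator v : ℤ) ∣ (p : ℤ) := by
      rcases neg_one_pow_eq_or ℤ (p / 2) with h1 | h1 <;> rw [h1] at h <;> simpa using h
    exact hv ((Nat.prime_dvd_prime_iff_eq (prime_natGenerator v) hp.out).mp (by exact_mod_cast h'))

/-- **`N(E ⊗ χ_{p*}) = N(E)` for an additive pair at `p ≥ 5`.** For `C • V^{(p*)} = W` with `V`, `W`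
globally minimal and BOTH additive at `p ≥ 5`: the conductor exponents agree at every place — at
`p` both are `2` (the wild part vanishes at `p ≥ 5`: gen 9's `condExpTwo_of_addv_of_five_le`,
Silverman *ATAEC* IV.10.4), away from `p` by `conductorExponent_eq_of_twist_pStar_of_ne` — and
`N = ∏ p^{f_p}` (tree `factorization_conductorNorm_holds`, *AEC* C.16). Hence the newforms of `E`
and of `E ⊗ χ_{p*}` are on the same `Γ₀(N)`. [cite: SilvermanAEC2009, C.16]
[cite: SilvermanATAEC1994, IV.9.4 (PDF pp. 344–346)] -/
theorem conductorNorm_eq_of_twist_pStar (hp5 : 5 ≤ p) (V W : WeierstrassCurve ℚ)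
    [V.IsElliptic] [V.IsGloballyMinimal] [W.IsElliptic] [W.IsGloballyMinimal]
    (hV : Addv V p) (hW : Addv W p) (C : VariableChange ℚ)
    (hC : C • V.quadraticTwist ((-1 : ℚ) ^ (p / 2) * p) = W) :
    W.conductorNorm ℤ = V.conductorNorm ℤ := by
  have hp2 : p ≠ 2 := by omega
  refine Nat.eq_of_factorization_eq (W.conductorNorm_pos_holds).ne' (V.conductorNorm_pos_holds).ne'
    fun q ↦ ?_
  by_cases hq : q.Prime
  · haveI : Fact q.Prime := ⟨hq⟩
    have hgen : natGenerator (placeOf q) = q :=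
      Literature.NumberTheory.EllipticCurves.Rat.natGenerator_primesEquiv_symm ⟨q, hq⟩
    have hW' := W.factorization_conductorNorm_holds (placeOf q)
    have hV' := V.factorization_conductorNorm_holds (placeOf q)
    rw [hgen] at hW' hV'
    rw [hW', hV']
    by_cases hqp : q = p
    · subst hqp
      have h1 : condExp W q = 2 := condExpTwo_of_addv_of_five_le W q hp5 hW
      have h2 : condExp V q = 2 := condExpTwo_of_addv_of_five_le V q hp5 hV
      unfold condExp at h1 h2
      rw [h1, h2]
    · exact conductorExponent_eq_of_twist_pStar_of_ne p hp2 V W C hC (placeOf q)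
        (by rw [hgen]; exact hqp)
  · rw [Nat.factorization_eq_zero_of_not_prime _ hq, Nat.factorization_eq_zero_of_not_prime _ hq]

/-! ### §4 The twist exists as a globally minimal model; `p*` as an integer -/

omit hp in
/-- `p* = (−1)^{⌊p/2⌋} p` is `p` or `−p`, as an integer, and casts to the cell's rational `p*`.
[folklore] -/
theorem pStar_intCast :
    (((-1 : ℤ) ^ (p / 2) * p : ℤ) : ℚ) = (-1 : ℚ) ^ (p / 2) * p ∧
      (((-1 : ℤ) ^ (p / 2) * p : ℤ) = p ∨ ((-1 : ℤ) ^ (p / 2) * p : ℤ) = -p) := by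
  refine ⟨by push_cast; ring, ?_⟩
  rcases neg_one_pow_eq_or ℤ (p / 2) with h | h <;> rw [h] <;> simp

/-- **Every pair has a globally minimal model of its `p*`-twist**: for `V/ℚ` elliptic there are a
globally minimal elliptic `W` and `C` with `C • V^{(p*)} = W` (tree `hasGlobalMinimalModel_rat_holds`,
Silverman *AEC* VIII.8.3 over `ℚ`). [cite: SilvermanAEC2009, VIII.8.3] -/
theorem exists_minimal_twist_pStar (V : WeierstrassCurve ℚ) [V.IsElliptic] :
    ∃ (W : WeierstrassCurve ℚ) (_ : W.IsElliptic) (_ : W.IsGloballyMinimal) (C : VariableChange ℚ),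
      C • V.quadraticTwist ((-1 : ℚ) ^ (p / 2) * p) = W := by
  have hd0 : ((-1 : ℚ) ^ (p / 2) * p) ≠ 0 :=
    mul_ne_zero (pow_ne_zero _ (by norm_num)) (by exact_mod_cast hp.out.ne_zero)
  haveI := V.isElliptic_quadraticTwist hd0
  obtain ⟨C, hCmin⟩ := hasGlobalMinimalModel_rat_holds (V.quadraticTwist ((-1 : ℚ) ^ (p / 2) * p))
  exact ⟨C • V.quadraticTwist ((-1 : ℚ) ^ (p / 2) * p), inferInstance, hCmin, C, rfl⟩

/-- **`p*`-versions of §1–§2** for `C • V^{(p*)} = W` (the cell's rational `p*`), `V, W` globally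
minimal, `p` odd, `ord_p Δ_min(V) < 6`: `ord_p u(C) = 0` and `ord_p Δ_min(W) = ord_p Δ_min(V) + 6`.
[cite: SilvermanAEC2009, VII.1 Prop. 1.3(b)] [cite: Pal2012, Prop. 2.5] -/
theorem padicValRat_u_eq_zero_and_padicValInt_eq_of_twist_pStar (hp2 : p ≠ 2)
    (V W : WeierstrassCurve ℚ) [V.IsElliptic] [V.IsGloballyMinimal] [W.IsElliptic]
    [W.IsGloballyMinimal] (hV : padicValInt p V.minimalDiscriminantInt < 6) (C : VariableChange ℚ)
    (hC : C • V.quadraticTwist ((-1 : ℚ) ^ (p / 2) * p) = W) :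
    padicValRat p (C.u : ℚ) = 0 ∧
      padicValInt p W.minimalDiscriminantInt = padicValInt p V.minimalDiscriminantInt + 6 := by
  obtain ⟨hcast, hd⟩ := pStar_intCast p
  rw [← hcast] at hC
  exact ⟨padicValRat_u_eq_zero_of_twist_pm_p_of_lt_six p hp2 V W hV hd C hC,
    padicValInt_minimalDiscriminantInt_twist_pm_p_of_lt_six p hp2 V W hV hd C hC⟩

/-- **`p*`-version of `addv_of_twist_pm_p_of_lt_six`**: for `C • V^{(p*)} = W`, `V, W` globally
minimal, `p` odd, `0 ≤ ord_p j(V)`, `ord_p Δ_min(V) < 6`: `W` is additive at `p`, `0 ≤ ord_p j(W)`,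
`6 ≤ ord_p Δ_min(W)`. [cite: SilvermanAEC2009, VII.5 Prop. 5.1] -/
theorem addv_of_twist_pStar (hp2 : p ≠ 2) (V W : WeierstrassCurve ℚ) [V.IsElliptic]
    [V.IsGloballyMinimal] [W.IsElliptic] [W.IsGloballyMinimal] (hj : 0 ≤ padicValRat p V.j)
    (hV : padicValInt p V.minimalDiscriminantInt < 6) (C : VariableChange ℚ)
    (hC : C • V.quadraticTwist ((-1 : ℚ) ^ (p / 2) * p) = W) :
    Addv W p ∧ 0 ≤ padicValRat p W.j ∧ 6 ≤ padicValInt p W.minimalDiscriminantInt := by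
  obtain ⟨hcast, hd⟩ := pStar_intCast p
  rw [← hcast] at hC
  exact addv_of_twist_pm_p_of_lt_six p hp2 V W hj hV hd C hC

end Summit.BirchSwinnertonDyer.Rank1Residual.Additive

end
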